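import Literature.NumberTheory.LFunctions.LagariasXiPositivityEq14Proofs
import Literature.NumberTheory.LFunctions.RiemannXiLogDeriv
import Mathlib.Analysis.InnerProductSpace.Calculus
import Mathlib.Analysis.Complex.RealDeriv
import HarnessLib

/-!
# Sondow–Dumitrescu 2010: `|ξ|` is monotone along horizontal half-lines; `RH ⟺ |ξ(σ+it)|` increasing for `σ > ½`

Trunk T-ANT (`Literature/NumberTheory/LFunctions`). J. Sondow, C. Dumitrescu, *A monotonicity property of
Riemann's xi function and a reformulation of the Riemann hypothesis*, Period. Math. Hungar. 60 (2010) 37–40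
(arXiv:1005.1104). AS PRINTED ("increasing and decreasing will mean strictly so, and a half-line will be a
half-infinite line not including its endpoint" [§1]):

* **Theorem 1.** "The xi function is increasing in modulus along every horizontal half-line lying in any open
  right half-plane that contains no xi zeros. Similarly, the modulus decreases on each horizontal half-line
  in any zero-free, open left half-plane." … "For example, since ξ(s) ≠ 0 outside the critical strip, if t is
  any fixed number, then |ξ(σ + it)| is increasing for 1 < σ < ∞ and decreasing for −∞ < σ < 0."
  [cite: SondowDumitrescu2010, Thm 1]
* **Corollary 1.** "The following statements are equivalent. (i) If t is any fixed real number, then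
  |ξ(σ + it)| is increasing for ½ < σ < ∞. (ii) If t is any fixed real number, then |ξ(σ + it)| is
  decreasing for −∞ < σ < ½. (iii) The Riemann Hypothesis is true." [cite: SondowDumitrescu2010, Cor 1]

## What is proved here (everything; no named facts; the calculus/symmetry helpers are `private`)

* `norm_riemannXi_strictMonoOn_of_zeroFree` — Theorem 1 for right half-planes `{re s > θ}` with `θ ≥ ½`
  (the only non-vacuous case: by `ξ(1−s) = ξ(s)` a zero-free `{re s > θ}` with `θ < ½` would make `ξ`
  zero-free, which it is not — that remark is not formalised), and `norm_riemannXi_strictAntiOn_of_zeroFree`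
  — the left half-plane form (`θ ≤ ½`), through the symmetry `|ξ((1−σ)+it)| = |ξ(σ+it)|`
  (`norm_riemannXi_one_sub_re`);
* the printed example, unconditionally: `norm_riemannXi_strictMonoOn_Ioi_one`,
  `norm_riemannXi_strictAntiOn_Iio_zero`;
* Corollary 1: `riemannHypothesis_iff_norm_riemannXi_strictMonoOn` ((iii) ⟺ (i)) and
  `riemannHypothesis_iff_norm_riemannXi_strictAntiOn` ((iii) ⟺ (ii)), with Mathlib's `RiemannHypothesis`.

## Method

Sondow–Dumitrescu prove Theorem 1 from the Hadamard product of `ξ`. Here it is read off the tree's pointwise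
positivity criterion for `Re ξ′/ξ` (Lagarias 1999, (1.4)–(1.5), after Matiyasevich–Saidak–Zvengrowski; PROVED
in `LagariasXiPositivityEq14Proofs.lean` as `Lagarias1999Eq14.re_logDeriv_riemannXi_pos_of_offLine`): if every
off-line zero `ρ = β + iγ` of `ζ` has `(β − ½)² < (σ − ½)² + (t − γ)²` then `Re ξ′/ξ(σ + it) > 0`. When
`{re s > θ}`, `θ ≥ ½`, carries no zero of `ξ`, every nontrivial zero has `|β − ½| ≤ θ − ½ < σ − ½` for `σ > θ`
(using `ξ(1 − s) = ξ(s)`), so the criterion applies along the whole half-line; and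
`d/dσ |ξ(σ + it)|² = 2 Re(conj ξ · ξ′)(σ + it) = 2 |ξ|² · Re ξ′/ξ > 0` (`HasDerivAt.norm_sq`), whence strict
monotonicity (`strictMonoOn_of_deriv_pos`). Corollary 1: (iii) ⇒ (i)/(ii) is Theorem 1 with `θ = ½`;
(i) ⇒ (iii) as printed — "If |ξ(s)| is increasing along a half-line L (or decreasing on L), then ξ(s) cannot
have a zero on L. It follows, using the functional equation, that each of the statements (i) and (ii) implies
(iii)" [cite: SondowDumitrescu2010, proof of Cor 1]: a zero `ρ` of `ζ` in the strip with `re ρ > ½` would give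
`|ξ(σ′ + i·im ρ)| < |ξ(ρ)| = 0` for `½ < σ′ < re ρ`; one with `re ρ < ½` is moved across by `ξ(1 − ρ) = ξ(ρ)`.

## References

* [SondowDumitrescu2010] J. Sondow, C. Dumitrescu, Period. Math. Hungar. 60 (2010) 37–40, Thm 1, Cor 1.
* [LagariasXiPositivity1999] J. C. Lagarias, Acta Arith. 89 (1999) 217–234, (1.4)–(1.5).
* H. L. Montgomery, R. C. Vaughan, *Multiplicative Number Theory I* (2007), §13.2 Exercise 1(e) — the
  exercise Corollary 1 "slightly improves" [cite: SondowDumitrescu2010, §1].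
-/

noncomputable section

open Complex Set
open scoped ComplexConjugate

namespace Literature.NumberTheory.LFunctions

namespace SondowDumitrescu2010

/-! ## Calculus on a horizontal line -/

/-- The restriction of `ξ` to the horizontal line `im s = t` is real-differentiable at `σ`, with derivative
`ξ′(σ + it)`. [folklore] -/
private theorem hasDerivAt_riemannXi_horizontal (σ t : ℝ) :
    HasDerivAt (fun x : ℝ => riemannXi ((x : ℂ) + t * I))
      (deriv riemannXi ((σ : ℂ) + t * I)) σ := by
  have h1 : HasDerivAt (fun z : ℂ => riemannXi (z + t * I))
      (deriv riemannXi ((σ : ℂ) + t * I)) (σ : ℂ) := by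
    have hd := (differentiable_riemannXi ((σ : ℂ) + t * I)).hasDerivAt
    have h2 : HasDerivAt (fun z : ℂ => z + t * I) 1 (σ : ℂ) := (hasDerivAt_id (σ : ℂ)).add_const _
    have h3 := hd.comp (σ : ℂ) h2
    simp only [mul_one, Function.comp_def] at h3
    exact h3
  exact h1.comp_ofReal

/-- `d/dσ |ξ(σ + it)|² = 2 Re(conj ξ(σ + it) · ξ′(σ + it))`. [folklore] -/
private theorem hasDerivAt_norm_sq_riemannXi_horizontal (σ t : ℝ) :
    HasDerivAt (fun x : ℝ => ‖riemannXi ((x : ℂ) + t * I)‖ ^ 2)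
      (2 * (conj (riemannXi ((σ : ℂ) + t * I)) * deriv riemannXi ((σ : ℂ) + t * I)).re) σ := by
  have h := (hasDerivAt_riemannXi_horizontal σ t).norm_sq
  rw [Complex.inner, mul_comm (deriv riemannXi _)] at h
  exact h

/-- Where `Re ξ′/ξ > 0`, the `σ`-derivative of `|ξ|²` is positive:
`Re(conj ξ · ξ′) = |ξ|² · Re(ξ′/ξ)`. [folklore] -/
private theorem re_conj_mul_deriv_pos {s : ℂ} (h : 0 < (logDeriv riemannXi s).re) :
    0 < (conj (riemannXi s) * deriv riemannXi s).re := by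
  have hne : riemannXi s ≠ 0 := by
    intro h0
    simp [logDeriv_apply, h0] at h
  have key : conj (riemannXi s) * deriv riemannXi s
      = ((Complex.normSq (riemannXi s) : ℝ) : ℂ) * logDeriv riemannXi s := by
    rw [logDeriv_apply, Complex.normSq_eq_conj_mul_self]
    field_simp
  rw [key, Complex.re_ofReal_mul]
  exact mul_pos (Complex.normSq_pos.2 hne) h

/-- From `Re ξ′/ξ > 0` along the open half-line `{σ + it : σ > θ}` to strict increase of `|ξ(σ + it)|`
there (mean value theorem applied to `|ξ|²`). [folklore] -/
private theorem norm_riemannXi_strictMonoOn_of_re_logDeriv_pos {θ : ℝ} (t : ℝ)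
    (hpos : ∀ σ : ℝ, θ < σ → 0 < (logDeriv riemannXi ((σ : ℂ) + t * I)).re) :
    StrictMonoOn (fun σ : ℝ => ‖riemannXi ((σ : ℂ) + t * I)‖) (Ioi θ) := by
  have hsq : StrictMonoOn (fun σ : ℝ => ‖riemannXi ((σ : ℂ) + t * I)‖ ^ 2) (Ioi θ) := by
    refine strictMonoOn_of_deriv_pos (convex_Ioi θ) ?_ ?_
    · have hc : Continuous fun σ : ℝ => riemannXi ((σ : ℂ) + t * I) :=
        differentiable_riemannXi.continuous.comp (by fun_prop)
      exact ((continuous_norm.comp hc).pow 2).continuousOn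
    · intro x hx
      rw [interior_Ioi] at hx
      rw [(hasDerivAt_norm_sq_riemannXi_horizontal x t).deriv]
      exact mul_pos two_pos (re_conj_mul_deriv_pos (hpos x hx))
  intro a ha b hb hab
  exact lt_of_pow_lt_pow_left₀ 2 (norm_nonneg _) (hsq ha hb hab)

/-- `|ξ((1 − σ) + it)| = |ξ(σ + it)|`: functional equation `ξ(1 − s) = ξ(s)` and Schwarz reflection
`ξ(s̄) = conj ξ(s)`. [folklore] -/
private theorem norm_riemannXi_one_sub_re (σ t : ℝ) :
    ‖riemannXi (((1 - σ : ℝ) : ℂ) + t * I)‖ = ‖riemannXi ((σ : ℂ) + t * I)‖ := by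
  have h : (((1 - σ : ℝ) : ℂ) + t * I) = 1 - conj ((σ : ℂ) + t * I) := by
    apply Complex.ext
    · simp
    · simp
  rw [h, riemannXi_one_sub, riemannXi_conj_holds, Complex.norm_conj]

/-! ## Theorem 1 -/

/-- **Sondow–Dumitrescu 2010, Theorem 1 (right half-planes).** If `ξ` has no zeros with `re s > θ`, where
`θ ≥ ½`, then for every real `t` the modulus `|ξ(σ + it)|` is strictly increasing for `θ < σ < ∞`.
(For `θ < ½` the hypothesis cannot hold, by `ξ(1 − s) = ξ(s)`; that case of the printed statement is vacuous.)
[cite: SondowDumitrescu2010, Thm 1] -/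
theorem norm_riemannXi_strictMonoOn_of_zeroFree {θ : ℝ} (hθ : 1 / 2 ≤ θ)
    (hfree : ∀ s : ℂ, θ < s.re → riemannXi s ≠ 0) (t : ℝ) :
    StrictMonoOn (fun σ : ℝ => ‖riemannXi ((σ : ℂ) + t * I)‖) (Ioi θ) := by
  refine norm_riemannXi_strictMonoOn_of_re_logDeriv_pos t fun σ hσ => ?_
  have hs : ((σ : ℂ) + t * I).re = σ := by simp
  have hsi : ((σ : ℂ) + t * I).im = t := by simp
  refine Lagarias1999Eq14.re_logDeriv_riemannXi_pos_of_offLine (by rw [hs]; linarith) ?_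
  intro ρ hζ h0 h1 _
  have hξ : riemannXi ρ = 0 := by
    refine riemannXi_eq_zero_of_nontrivial hζ ?_ ?_
    · rintro ⟨n, hn⟩
      have := congrArg Complex.re hn
      simp at this
      linarith [(n.cast_nonneg : (0 : ℝ) ≤ n)]
    · rintro rfl
      norm_num at h1
  have hle : ρ.re ≤ θ := not_lt.1 fun h => hfree ρ h hξ
  have hge : 1 - ρ.re ≤ θ := by
    refine not_lt.1 fun h => hfree (1 - ρ) ?_ (by rwa [riemannXi_one_sub])
    simp only [sub_re, one_re]
    exact h
  rw [hs, hsi]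
  have h3 : (ρ.re - 1 / 2) ^ 2 ≤ (θ - 1 / 2) ^ 2 := by nlinarith
  have h4 : (θ - 1 / 2) ^ 2 < (σ - 1 / 2) ^ 2 := by nlinarith
  nlinarith [sq_nonneg (t - ρ.im)]

/-- **Sondow–Dumitrescu 2010, Theorem 1 (left half-planes).** If `ξ` has no zeros with `re s < θ`, where
`θ ≤ ½`, then for every real `t` the modulus `|ξ(σ + it)|` is strictly decreasing for `−∞ < σ < θ`.
[cite: SondowDumitrescu2010, Thm 1] -/
theorem norm_riemannXi_strictAntiOn_of_zeroFree {θ : ℝ} (hθ : θ ≤ 1 / 2)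
    (hfree : ∀ s : ℂ, s.re < θ → riemannXi s ≠ 0) (t : ℝ) :
    StrictAntiOn (fun σ : ℝ => ‖riemannXi ((σ : ℂ) + t * I)‖) (Iio θ) := by
  have hfree' : ∀ s : ℂ, 1 - θ < s.re → riemannXi s ≠ 0 := by
    intro s hs
    rw [← riemannXi_one_sub]
    refine hfree (1 - s) ?_
    simp only [sub_re, one_re]
    linarith
  have hmono := norm_riemannXi_strictMonoOn_of_zeroFree (θ := 1 - θ) (by linarith) hfree' t
  intro a ha b hb hab
  simp only [mem_Iio] at ha hb
  have h := hmono (show 1 - b ∈ Ioi (1 - θ) by simp only [mem_Ioi]; linarith)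
    (show 1 - a ∈ Ioi (1 - θ) by simp only [mem_Ioi]; linarith) (by linarith : 1 - b < 1 - a)
  simp only at h
  rwa [norm_riemannXi_one_sub_re, norm_riemannXi_one_sub_re] at h

/-- The printed example, right: "since ξ(s) ≠ 0 outside the critical strip, if t is any fixed number, then
|ξ(σ + it)| is increasing for 1 < σ < ∞" — unconditional. [cite: SondowDumitrescu2010, Thm 1] -/
theorem norm_riemannXi_strictMonoOn_Ioi_one (t : ℝ) :
    StrictMonoOn (fun σ : ℝ => ‖riemannXi ((σ : ℂ) + t * I)‖) (Ioi 1) :=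
  norm_riemannXi_strictMonoOn_of_zeroFree (by norm_num)
    (fun _ hs => riemannXi_ne_zero_of_one_le_re hs.le) t

/-- The printed example, left: "… and decreasing for −∞ < σ < 0" — unconditional.
[cite: SondowDumitrescu2010, Thm 1] -/
theorem norm_riemannXi_strictAntiOn_Iio_zero (t : ℝ) :
    StrictAntiOn (fun σ : ℝ => ‖riemannXi ((σ : ℂ) + t * I)‖) (Iio 0) :=
  norm_riemannXi_strictAntiOn_of_zeroFree (by norm_num)
    (fun _ hs => riemannXi_ne_zero_of_re_le_zero hs.le) t

/-! ## Corollary 1 -/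

/-- Under `RiemannHypothesis` (Mathlib's statement), `ξ` has no zero off the critical line: "if (iii) holds,
then ξ(s) ≠ 0 on the right and left open half-planes of the critical line" (a zero of `ξ` is a zero of `ζ`
in the open strip, `riemannXi_zero_prop`). [cite: SondowDumitrescu2010, proof of Cor 1] -/
theorem riemannXi_ne_zero_of_RH (hRH : RiemannHypothesis) {s : ℂ} (hs : s.re ≠ 1 / 2) :
    riemannXi s ≠ 0 := by
  intro h0
  obtain ⟨hζ, h0re, h1re, -⟩ := riemannXi_zero_prop h0
  refine hs (hRH s hζ ?_ ?_)
  · rintro ⟨n, hn⟩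
    have := congrArg Complex.re hn
    simp at this
    linarith [(n.cast_nonneg : (0 : ℝ) ≤ n)]
  · rintro rfl
    norm_num at h1re

/-- **Sondow–Dumitrescu 2010, Corollary 1, (iii) ⟺ (i):** the Riemann hypothesis holds iff for every real
`t` the modulus `|ξ(σ + it)|` is strictly increasing for `½ < σ < ∞`. [cite: SondowDumitrescu2010, Cor 1] -/
theorem riemannHypothesis_iff_norm_riemannXi_strictMonoOn :
    RiemannHypothesis ↔
      ∀ t : ℝ, StrictMonoOn (fun σ : ℝ => ‖riemannXi ((σ : ℂ) + t * I)‖) (Ioi (1 / 2)) := by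
  constructor
  · intro hRH t
    exact norm_riemannXi_strictMonoOn_of_zeroFree le_rfl
      (fun s hs => riemannXi_ne_zero_of_RH hRH (ne_of_gt hs)) t
  · intro hmono s hζ htriv hone
    have hξ : riemannXi s = 0 := riemannXi_eq_zero_of_nontrivial hζ htriv hone
    -- no zero of `ξ` lies strictly to the right of the critical line
    have key : ∀ ρ : ℂ, riemannXi ρ = 0 → ¬ 1 / 2 < ρ.re := by
      intro ρ hρ hlt
      have h := hmono ρ.im (show (1 / 2 + ρ.re) / 2 ∈ Ioi (1 / 2 : ℝ) by simp only [mem_Ioi]; linarith)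
        (show ρ.re ∈ Ioi (1 / 2 : ℝ) from hlt) (by linarith : (1 / 2 + ρ.re) / 2 < ρ.re)
      simp only [Complex.re_add_im] at h
      rw [hρ, norm_zero] at h
      exact absurd h (not_lt.2 (norm_nonneg _))
    rcases lt_trichotomy s.re (1 / 2) with hlt | heq | hgt
    · exfalso
      refine key (1 - s) (by rwa [riemannXi_one_sub]) ?_
      simp only [sub_re, one_re]
      linarith
    · exact heq
    · exact (key s hξ hgt).elim

/-- **Sondow–Dumitrescu 2010, Corollary 1, (iii) ⟺ (ii):** the Riemann hypothesis holds iff for every real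
`t` the modulus `|ξ(σ + it)|` is strictly decreasing for `−∞ < σ < ½`. [cite: SondowDumitrescu2010, Cor 1] -/
theorem riemannHypothesis_iff_norm_riemannXi_strictAntiOn :
    RiemannHypothesis ↔
      ∀ t : ℝ, StrictAntiOn (fun σ : ℝ => ‖riemannXi ((σ : ℂ) + t * I)‖) (Iio (1 / 2)) := by
  constructor
  · intro hRH t
    exact norm_riemannXi_strictAntiOn_of_zeroFree le_rfl
      (fun s hs => riemannXi_ne_zero_of_RH hRH (ne_of_lt hs)) t
  · intro hanti
    refine riemannHypothesis_iff_norm_riemannXi_strictMonoOn.2 fun t => ?_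
    intro a ha b hb hab
    simp only [mem_Ioi] at ha hb
    have h := hanti t (show 1 - b ∈ Iio (1 / 2 : ℝ) by simp only [mem_Iio]; linarith)
      (show 1 - a ∈ Iio (1 / 2 : ℝ) by simp only [mem_Iio]; linarith) (by linarith : 1 - b < 1 - a)
    simp only at h
    rwa [norm_riemannXi_one_sub_re, norm_riemannXi_one_sub_re] at h

end SondowDumitrescu2010

end Literature.NumberTheory.LFunctions

end
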